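import Mathlib.RingTheory.Valuation.ValuationSubring
import Mathlib.LinearAlgebra.Dimension.Finrank
import Mathlib.LinearAlgebra.FiniteDimensional.Lemmas
import Mathlib.LinearAlgebra.Dimension.StrongRankCondition
import HarnessLib

/-!
# Relations among values: more than `r` elements are multiplicatively dependent when `r` values span

Topic: `Literature/AlgebraicGeometry/Resolution`. PROOF side of `CossartPiltant2019ReductionP`
(`ArithmeticalThreefoldsLocal.lean`), input (C4), [CoP1] Prop. 8.1 (V. Cossart, O. Piltant,
HAL hal-00139124, pp. 22–23). The loop "`♯E = ♯F ≤ r`" of the printed proof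
(`MonoidalSupportReduction.lean`, `exists_frameStepsTracked_card_supp_le`) consumes a supplier
`hdep` of non-trivial multiplicative relations among the values of any family of more than `r`
nonzero elements; in print this is "`W y₁, …, W y_r` generate `W L ⊗_ℤ ℚ`" (so that
`W y_{r+1} ∈ ⊕ᵢ ℚ W yᵢ`, the hypothesis of Lemma 8.2), `r` being the rational rank of `W`.
This file PROVES the supplier from a RATIONALLY SPANNING family `g₁, …, g_r` of nonzero
elements (every nonzero `y` has `v(y)ⁿ ∏ v(gᵢ)^{bᵢ} = ∏ v(gᵢ)^{aᵢ}` for some `n > 0`): the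
exponent vectors `aₖ − bₖ ∈ ℤʳ` of more than `r` elements are `ℤ`-linearly dependent
(`LinearIndependent.fintype_card_le_finrank`), and a dependence `∑ κₖ (aₖ − bₖ) = 0` gives
the relation with `cₖ = nₖ κₖ` (`exists_relation_of_spanning`).

Everything is PROVED; no named facts, definitions, instances or notation are introduced.

## Sources

* V. Cossart, O. Piltant, J. Algebra 320 (2008) 1051–1082: proof of Prop. 8.1, (33) and the
  hypothesis of Lemma 8.2 (HAL hal-00139124, pp. 22–23). [CossartPiltant2008]
-/

noncomputable section

namespace Literature.AlgebraicGeometry.Resolution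

universe u

open Function

section Relations

variable {E : Type u} [Field E] (O : ValuationSubring E)

set_option maxHeartbeats 800000 in
/-- **More than `r` values are dependent when `r` values span rationally** ([CoP1] proof of
Prop. 8.1: "`W y₁, …, W y_r` generate `W L ⊗_ℤ ℚ`", whence the hypothesis
"`V x_{r+1} ∈ ⊕ᵢ ℚ V xᵢ`" of Lemma 8.2). If `g₁, …, g_r` are nonzero and every nonzero `y`
satisfies `v(y)ⁿ · ∏ v(gᵢ)^{bᵢ} = ∏ v(gᵢ)^{aᵢ}` for some `n > 0`, `a, b ∈ ℕʳ`, then for every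
family `y` of nonzero elements and every index set `I` with `♯I > r` there is `c : ι → ℤ`,
`c ≠ 0`, supported on `I`, with `∏ v(yₖ)^{cₖ⁺} = ∏ v(yₖ)^{cₖ⁻}`.
[cite: CossartPiltant2008, proof of Prop. 8.1 (HAL pp. 22–23)] -/
theorem exists_relation_of_spanning {r : ℕ} (g : Fin r → E) (hg : ∀ i, g i ≠ 0)
    (hspan : ∀ y : E, y ≠ 0 → ∃ (n : ℕ) (a b : Fin r → ℕ), 0 < n ∧
      O.valuation y ^ n * ∏ i, O.valuation (g i) ^ b i = ∏ i, O.valuation (g i) ^ a i)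
    {ι : Type*} [Fintype ι] [DecidableEq ι] (I : Finset ι) (y : ι → E) (hI : r < I.card)
    (hy : ∀ k, y k ≠ 0) :
    ∃ c : ι → ℤ, (∀ k, k ∉ I → c k = 0) ∧ c ≠ 0 ∧
      ∏ k, O.valuation (y k) ^ (c k).toNat = ∏ k, O.valuation (y k) ^ (-c k).toNat := by
  classical
  -- the data for each `k`
  choose n a b hn hrel using fun k => hspan (y k) (hy k)
  -- units of the value group, written additively
  have hvy : ∀ k, O.valuation (y k) ≠ 0 := fun k h => hy k ((Valuation.zero_iff _).mp h)
  have hvg : ∀ i, O.valuation (g i) ≠ 0 := fun i h => hg i ((Valuation.zero_iff _).mp h)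
  let Y : ι → Additive (O.ValueGroup)ˣ := fun k => Additive.ofMul (Units.mk0 _ (hvy k))
  let G : Fin r → Additive (O.ValueGroup)ˣ := fun i => Additive.ofMul (Units.mk0 _ (hvg i))
  -- the relations, additively: `n_k • Y_k = ∑ i, w k i • G i`
  let w : ι → Fin r → ℤ := fun k i => (a k i : ℤ) - b k i
  have hadd : ∀ k, (n k : ℤ) • Y k = ∑ i, w k i • G i := by
    intro k
    have hu : (Units.mk0 _ (hvy k)) ^ n k * ∏ i, (Units.mk0 _ (hvg i)) ^ b k i =
        ∏ i, (Units.mk0 _ (hvg i)) ^ a k i := by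
      apply Units.val_injective
      simp only [Units.val_mul, Units.val_pow_eq_pow_val, Units.coe_prod, Units.val_mk0]
      exact hrel k
    have h2 := congrArg Additive.ofMul hu
    simp only [ofMul_mul, ofMul_pow, ofMul_prod] at h2
    -- `h2 : n k • Y k + ∑ i, b k i • G i = ∑ i, a k i • G i`
    have h3 : (n k : ℤ) • Y k = ∑ i, ((a k i : ℤ) • G i - (b k i : ℤ) • G i) := by
      rw [Finset.sum_sub_distrib]
      simp only [natCast_zsmul]
      rw [eq_sub_iff_add_eq]
      exact h2
    rw [h3]
    refine Finset.sum_congr rfl fun i _ => ?_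
    rw [← sub_smul]
  -- more than `r` integer vectors in `ℤʳ` are dependent
  have hdep : ¬ LinearIndependent ℤ (fun k : I => w k) := by
    intro hli
    have h1 := hli.fintype_card_le_finrank
    rw [Module.finrank_fintype_fun_eq_card, Fintype.card_fin, Fintype.card_coe] at h1
    omega
  obtain ⟨κ, hκ, k₀, hk₀⟩ := Fintype.not_linearIndependent_iff.mp hdep
  -- the relation vector
  refine ⟨fun k => if hk : k ∈ I then (n k : ℤ) * κ ⟨k, hk⟩ else 0, fun k hk => dif_neg hk, ?_, ?_⟩
  · intro h0
    have := congr_fun h0 (k₀ : ι)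
    simp only [k₀.2, dif_pos, Pi.zero_apply, mul_eq_zero, Nat.cast_eq_zero] at this
    rcases this with h | h
    · exact (hn k₀).ne' h
    · exact hk₀ (by simpa using h)
  · -- `∑ k, c k • Y k = 0`
    set c : ι → ℤ := fun k => if hk : k ∈ I then (n k : ℤ) * κ ⟨k, hk⟩ else 0 with hcdef
    have hcI : ∀ k : I, c k = (n k : ℤ) * κ k := fun k => by
      simp only [hcdef, k.2, dif_pos]
    have hsum : ∑ k, c k • Y k = 0 := by
      have h1 : ∑ k, c k • Y k = ∑ k ∈ I, c k • Y k :=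
        (Finset.sum_subset (Finset.subset_univ I) (fun k _ hk => by
          simp only [hcdef, hk, dif_neg, not_false_eq_true, zero_smul])).symm
      have h2 : ∑ k ∈ I, c k • Y k = ∑ k : I, c k • Y k := by
        rw [Finset.univ_eq_attach, Finset.sum_attach I (fun k => c k • Y k)]
      rw [h1, h2]
      calc ∑ k : I, c (k : ι) • Y k = ∑ k : I, κ k • ((n k : ℤ) • Y k) := by
            refine Finset.sum_congr rfl fun k _ => ?_
            rw [hcI k, smul_smul, mul_comm]
        _ = ∑ k : I, ∑ i, (κ k * w k i) • G i := by
            refine Finset.sum_congr rfl fun k _ => ?_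
            rw [hadd k, Finset.smul_sum]
            refine Finset.sum_congr rfl fun i _ => ?_
            rw [smul_smul]
        _ = ∑ i, (∑ k : I, κ k * w k i) • G i := by
            rw [Finset.sum_comm]
            refine Finset.sum_congr rfl fun i _ => ?_
            rw [Finset.sum_smul]
        _ = 0 := by
            refine Finset.sum_eq_zero fun i _ => ?_
            have hi := congr_fun hκ i
            simp only [Finset.sum_apply, Pi.smul_apply, smul_eq_mul, Pi.zero_apply] at hi
            rw [hi, zero_smul]
    -- back to the value group: `∏ u_k ^ c_k = 1`
    have hprod : ∏ k, (Units.mk0 _ (hvy k)) ^ c k = 1 := by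
      have h1 : Additive.ofMul (∏ k, (Units.mk0 _ (hvy k)) ^ c k) = 0 := by
        rw [ofMul_prod]
        simp only [ofMul_zpow]
        exact hsum
      exact h1
    have hsplit : ∀ k, (Units.mk0 _ (hvy k)) ^ c k =
        (Units.mk0 _ (hvy k)) ^ (c k).toNat * ((Units.mk0 _ (hvy k)) ^ (-c k).toNat)⁻¹ := by
      intro k
      rw [← zpow_natCast, ← zpow_natCast, ← zpow_neg, ← zpow_add]
      congr 1
      have := Int.toNat_sub_toNat_neg (c k)
      omega
    have hprod' : ∏ k, (Units.mk0 _ (hvy k)) ^ (c k).toNat =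
        ∏ k, (Units.mk0 _ (hvy k)) ^ (-c k).toNat := by
      rw [Finset.prod_congr rfl fun k _ => hsplit k, Finset.prod_mul_distrib,
        Finset.prod_inv_distrib, mul_inv_eq_one] at hprod
      exact hprod
    have h := congrArg Units.val hprod'
    simp only [Units.coe_prod, Units.val_pow_eq_pow_val, Units.val_mk0] at h
    exact h

set_option maxHeartbeats 800000 in
/-- `exists_relation_of_spanning` for a family: it suffices that the values of the members
`yₖ` of the family be rationally dependent on `v(g₁), …, v(g_r)` (e.g. the `yₖ` are monomials
in `g` times units). [cite: CossartPiltant2008, proof of Prop. 8.1 (HAL pp. 22–23)] -/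
theorem exists_relation_of_spanning_family {r : ℕ} (g : Fin r → E) (hg : ∀ i, g i ≠ 0)
    {ι : Type*} [Fintype ι] [DecidableEq ι] (I : Finset ι) (y : ι → E) (hI : r < I.card)
    (hy : ∀ k, y k ≠ 0)
    (hspan : ∀ k, ∃ (n : ℕ) (a b : Fin r → ℕ), 0 < n ∧
      O.valuation (y k) ^ n * ∏ i, O.valuation (g i) ^ b i = ∏ i, O.valuation (g i) ^ a i) :
    ∃ c : ι → ℤ, (∀ k, k ∉ I → c k = 0) ∧ c ≠ 0 ∧
      ∏ k, O.valuation (y k) ^ (c k).toNat = ∏ k, O.valuation (y k) ^ (-c k).toNat := by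
  classical
  -- the data for each `k`
  choose n a b hn hrel using hspan
  -- units of the value group, written additively
  have hvy : ∀ k, O.valuation (y k) ≠ 0 := fun k h => hy k ((Valuation.zero_iff _).mp h)
  have hvg : ∀ i, O.valuation (g i) ≠ 0 := fun i h => hg i ((Valuation.zero_iff _).mp h)
  let Y : ι → Additive (O.ValueGroup)ˣ := fun k => Additive.ofMul (Units.mk0 _ (hvy k))
  let G : Fin r → Additive (O.ValueGroup)ˣ := fun i => Additive.ofMul (Units.mk0 _ (hvg i))
  -- the relations, additively: `n_k • Y_k = ∑ i, w k i • G i`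
  let w : ι → Fin r → ℤ := fun k i => (a k i : ℤ) - b k i
  have hadd : ∀ k, (n k : ℤ) • Y k = ∑ i, w k i • G i := by
    intro k
    have hu : (Units.mk0 _ (hvy k)) ^ n k * ∏ i, (Units.mk0 _ (hvg i)) ^ b k i =
        ∏ i, (Units.mk0 _ (hvg i)) ^ a k i := by
      apply Units.val_injective
      simp only [Units.val_mul, Units.val_pow_eq_pow_val, Units.coe_prod, Units.val_mk0]
      exact hrel k
    have h2 := congrArg Additive.ofMul hu
    simp only [ofMul_mul, ofMul_pow, ofMul_prod] at h2
    -- `h2 : n k • Y k + ∑ i, b k i • G i = ∑ i, a k i • G i`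
    have h3 : (n k : ℤ) • Y k = ∑ i, ((a k i : ℤ) • G i - (b k i : ℤ) • G i) := by
      rw [Finset.sum_sub_distrib]
      simp only [natCast_zsmul]
      rw [eq_sub_iff_add_eq]
      exact h2
    rw [h3]
    refine Finset.sum_congr rfl fun i _ => ?_
    rw [← sub_smul]
  -- more than `r` integer vectors in `ℤʳ` are dependent
  have hdep : ¬ LinearIndependent ℤ (fun k : I => w k) := by
    intro hli
    have h1 := hli.fintype_card_le_finrank
    rw [Module.finrank_fintype_fun_eq_card, Fintype.card_fin, Fintype.card_coe] at h1
    omega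
  obtain ⟨κ, hκ, k₀, hk₀⟩ := Fintype.not_linearIndependent_iff.mp hdep
  -- the relation vector
  refine ⟨fun k => if hk : k ∈ I then (n k : ℤ) * κ ⟨k, hk⟩ else 0, fun k hk => dif_neg hk, ?_, ?_⟩
  · intro h0
    have := congr_fun h0 (k₀ : ι)
    simp only [k₀.2, dif_pos, Pi.zero_apply, mul_eq_zero, Nat.cast_eq_zero] at this
    rcases this with h | h
    · exact (hn k₀).ne' h
    · exact hk₀ (by simpa using h)
  · -- `∑ k, c k • Y k = 0`
    set c : ι → ℤ := fun k => if hk : k ∈ I then (n k : ℤ) * κ ⟨k, hk⟩ else 0 with hcdef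
    have hcI : ∀ k : I, c k = (n k : ℤ) * κ k := fun k => by
      simp only [hcdef, k.2, dif_pos]
    have hsum : ∑ k, c k • Y k = 0 := by
      have h1 : ∑ k, c k • Y k = ∑ k ∈ I, c k • Y k :=
        (Finset.sum_subset (Finset.subset_univ I) (fun k _ hk => by
          simp only [hcdef, hk, dif_neg, not_false_eq_true, zero_smul])).symm
      have h2 : ∑ k ∈ I, c k • Y k = ∑ k : I, c k • Y k := by
        rw [Finset.univ_eq_attach, Finset.sum_attach I (fun k => c k • Y k)]
      rw [h1, h2]
      calc ∑ k : I, c (k : ι) • Y k = ∑ k : I, κ k • ((n k : ℤ) • Y k) := by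
            refine Finset.sum_congr rfl fun k _ => ?_
            rw [hcI k, smul_smul, mul_comm]
        _ = ∑ k : I, ∑ i, (κ k * w k i) • G i := by
            refine Finset.sum_congr rfl fun k _ => ?_
            rw [hadd k, Finset.smul_sum]
            refine Finset.sum_congr rfl fun i _ => ?_
            rw [smul_smul]
        _ = ∑ i, (∑ k : I, κ k * w k i) • G i := by
            rw [Finset.sum_comm]
            refine Finset.sum_congr rfl fun i _ => ?_
            rw [Finset.sum_smul]
        _ = 0 := by
            refine Finset.sum_eq_zero fun i _ => ?_
            have hi := congr_fun hκ i
            simp only [Finset.sum_apply, Pi.smul_apply, smul_eq_mul, Pi.zero_apply] at hi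
            rw [hi, zero_smul]
    -- back to the value group: `∏ u_k ^ c_k = 1`
    have hprod : ∏ k, (Units.mk0 _ (hvy k)) ^ c k = 1 := by
      have h1 : Additive.ofMul (∏ k, (Units.mk0 _ (hvy k)) ^ c k) = 0 := by
        rw [ofMul_prod]
        simp only [ofMul_zpow]
        exact hsum
      exact h1
    have hsplit : ∀ k, (Units.mk0 _ (hvy k)) ^ c k =
        (Units.mk0 _ (hvy k)) ^ (c k).toNat * ((Units.mk0 _ (hvy k)) ^ (-c k).toNat)⁻¹ := by
      intro k
      rw [← zpow_natCast, ← zpow_natCast, ← zpow_neg, ← zpow_add]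
      congr 1
      have := Int.toNat_sub_toNat_neg (c k)
      omega
    have hprod' : ∏ k, (Units.mk0 _ (hvy k)) ^ (c k).toNat =
        ∏ k, (Units.mk0 _ (hvy k)) ^ (-c k).toNat := by
      rw [Finset.prod_congr rfl fun k _ => hsplit k, Finset.prod_mul_distrib,
        Finset.prod_inv_distrib, mul_inv_eq_one] at hprod
      exact hprod
    have h := congrArg Units.val hprod'
    simp only [Units.coe_prod, Units.val_pow_eq_pow_val, Units.val_mk0] at h
    exact h


end Relations

end Literature.AlgebraicGeometry.Resolution

end
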